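import Mathlib.Tactic.Linarith
import Mathlib.Tactic.NormNum
import Mathlib.LinearAlgebra.Span.Basic
import HarnessLib

/-!
# The (0,1) cell of the ι-window, XXV-D: the product ground `B₁ × B₂`, XII (ADDENDUM 3) — the monodromy lemma for Kummer pencils
# (report [XXV] §16): arithmetic and linear-algebra shadows

Family `hodge`, b2b cell `hweil` (helper of item stmt-HodgeConjecture-2524). Companion (`pg12c_*`) of
`WeilTypeLadderH2ProductGroundTwelve{,B,C}.lean` (same seat). Report `run/shared/lean/b2b/hodge-weil/b2b-hweil-pv1-g37/H2-ZERO-ONE-25.md`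
([XXV]) §16 (ADDENDUM 3). HONEST FRAMING: census results inside the ladder's H2 test ((0,1) cell) on the SPECIAL fourfold `X₀ = B₁ × B₂`;
nothing here is a rung; no case of the Hodge conjecture is proved; no statement of [Markman 2025] / [Perry 2026] / [EdGFS 2025] is used.
-/

-- mandated namespace `Summit.HodgeConjecture.HodgeConjecture.…` (Problem = Summit) trips `linter.dupNamespace`; the lakefile disables it
-- tree-wide (weak option), restated here so stand-alone elaboration is warning-free too.
set_option linter.dupNamespace false

namespace Summit.HodgeConjecture.HodgeConjecture.WeilTypeLadder

section ProductGroundTwelveAdd3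

/-- **LEMMA MONO / COROLLARY H_NS* ([XXV] 16.2–16.4): the bookkeeping.** `H₁` of the genus-5 member of the Kummer pencil has rank `10 = 4 + 6`
(the `B₁`-part and the Prym/quotient part `H₁(Ē_t)` of the genus-3 plane quartic); the vanishing classes span the rank-`6` part because their
orthogonal is the rank-`4` invariant part (`10 − 4 = 6`); the pencil has `16 + 4 = 20` critical values and the hypothesis of H_NS* is
`k ≤ 19 = 20 − 1` (one unmatched value); the critical-configuration map has image of dimension `≤ 3 + 4 = 7` in `M_{0,20}` of dimension
`20 − 3 = 17`. [`norm_num` / `omega`] -/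
theorem pg12c_mono_rank :
    (4 + 6 = (10:ℕ)) ∧ (10 - 4 = (6:ℕ)) ∧ (2 * 5 = (10:ℕ)) ∧ (2 * 3 = (6:ℕ)) ∧ (16 + 4 = (20:ℕ)) ∧ (20 - 1 = (19:ℕ)) ∧
    (3 + 4 = (7:ℕ)) ∧ (20 - 3 = (17:ℕ)) ∧ (7 < (17:ℕ)) ∧ (∀ k : ℕ, k ≤ 19 → k < 20) := by
  refine ⟨by norm_num, by norm_num, by norm_num, by norm_num, by norm_num, by norm_num, by norm_num, by norm_num, by norm_num, ?_⟩
  intro k hk; omega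

/-- **LEMMA MONO (3), the transvection dichotomy ([XXV] 16.2):** for a 'transvection-like' map `T x = x + f(x) • δ` on a module and a
submodule `W` stable under `T`, every `w ∈ W` has `f(w) • δ ∈ W` — so either `δ ∈ W` or `f` vanishes on `W` (over a field). Here in the
form actually used: `T w − w ∈ W`. [`Submodule.sub_mem`] -/
theorem pg12c_transvection_step {R M : Type*} [Ring R] [AddCommGroup M] [Module R M]
    (W : Submodule R M) (δ : M) (f : M → R) (T : M → M) (hT : ∀ x, T x = x + f x • δ)
    (hW : ∀ w ∈ W, T w ∈ W) : ∀ w ∈ W, f w • δ ∈ W := by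
  intro w hw
  have h1 : T w ∈ W := hW w hw
  rw [hT] at h1
  have h2 : w + f w • δ - w ∈ W := W.sub_mem h1 hw
  simpa using h2

end ProductGroundTwelveAdd3

end Summit.HodgeConjecture.HodgeConjecture.WeilTypeLadder
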